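import Summits.BirchSwinnertonDyer.BirchSwinnertonDyer.Theorems.PrintCf2SplitBadTwoLocalPointsScalarDyadic
import Summits.BirchSwinnertonDyer.BirchSwinnertonDyer.Theorems.PrintCf2SplitBadTwoRestrictedSelmerBottomLocalKummerRankOne
import Literature.NumberTheory.EllipticCurves.StrictSelmerRankOne
import Literature.NumberTheory.EllipticCurves.CanonicalPAdicHeightThetaProofs
import Literature.NumberTheory.EllipticCurves.VariableChangePointsMap
import Mathlib.Algebra.Algebra.Hom.Rat
import HarnessLib

/-!
# Crux `PrintCf2.SplitBadTwoRankOneOfFacts` (stmt-BirchSwinnertonDyer-20368), road α v10.3 — S3c (R-BV) factor (F1), piece (D):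
# TRANSPORT `E(K_w) = W(ℚ_p)` AT A DEGREE-ONE PLACE: divisibility modulo torsion of the ℚ-generator is the same in `E(K̄_w)^{Γ_{K_w}}` and in `W(ℚ_p)`

Cell `bsd-print-cf2`, width seat `bsd-line-cf2-p1-w6` g3 (prover-bsd-line-cf2-p1-w6-g3-0). `--supports stmt-BirchSwinnertonDyer-20368`
(helper, Theses-free). HONEST FRAMING: nothing here closes the crux or a registered stub; BSD is not proved by any of this; no summit
statement is proved by this seat. No definition, no named fact, no `sorry`.

WHAT. Piece (C) (`resOfLe_resSubgroup_kummerMapLevel_eq_zero_iff`, p676883) reads the local vanishing of `res_⊤ κ_N(P_K)` at `w` as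
«`P_K = p^N y + T` in `E(K̄_w)` with `y` fixed by `Γ_{K_w}`, `T` torsion», while (L2) (`DyadicTorsion.exists_pow_smul_add_torsion_iff_of_frame`,
p675150) computes «`P₂ = 2^N y + T` in `W(ℚ₂)`». THIS FILE identifies the two when `K_w ≅ ℚ_p` (a surjective `φ : ℚ_p →+* K_w`; on the S3c
frame `[K_{v̄} : ℚ₂] = e·f = 1`, -w7 g3 `LocalPointsScalar.ramificationIdx_mul_inertiaDeg_eq_one_of_ne`):
* `smul_map_toAlgHom_eq` — points of `(W_K)(K̄_w)` with coordinates in `K_w` are `Γ_{K_w}`-fixed;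
* **`exists_localPoints_iff_exists_padicPoint`** — for `W/ℚ` (any Weierstrass cubic), `P ∈ W(ℚ)`, `m : ℕ`:
  `(∃ y T ∈ E(K̄_w), y fixed, T torsion, m•y + T = P_K) ⟺ (∃ y T ∈ W(ℚ_p), T torsion, m•y + T = toPadicPoint p P)`.
  The comparison map is `y ↦ (ψ y)` on coordinates, `ψ = (K_w → K̄_w) ∘ φ` (`Affine.Point.map` along `ψ` as a `ℚ`-algebra map, then the
  transport `W_{K̄_w} = (W_K)_{K̄_w}`, `Affine.Point.congrEquiv`); it is injective, its image is the fixed part (Galois descent, tree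
  `exists_map_eq_of_forall_smul_localPoints_eq`, + surjectivity of `φ`), and it carries `toPadicPoint p P` to `pointsMap (toGeomPoints P_K)`
  (all three are «apply a ring map `ℚ → K̄_w` to the coordinates», and `ℚ →+* K̄_w` is unique);
* **`exists_localPoints_iff_exists_padicPoint_of_frame`** — the S3c instance at `v̄` (`K` quadratic, `v ≠ v̄` above `2`, `p = 2`).
presearch: Silverman AEC VIII §1 (Galois descent of points), Neukirch II (8.2)/(8.5) (`[K_w : ℚ_p] = e f`) — folklore transport; nothing filed.
beyond-print theorem: no.

References: [SilvermanAEC2009] I §1, VIII §1; [NeukirchANT1999] Ch. I §8 (8.2), Ch. II (8.5).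
-/

noncomputable section

open scoped Classical

set_option linter.dupNamespace false
set_option autoImplicit false

open NumberField IsDedekindDomain Field WeierstrassCurve
open Literature.NumberTheory.EllipticCurves Literature.NumberTheory.EllipticCurves.GreenbergSelmer
open Literature.NumberTheory.GaloisRepresentations (LocalField.adicCompletionPadicAlgebra)

namespace Summit.BirchSwinnertonDyer.BirchSwinnertonDyer.Theorems.PrintCf2.RestrictedSelmerPair

section Transport

variable {K : Type} [Field K] [NumberField K] (W : WeierstrassCurve ℚ) (p : ℕ) [Fact p.Prime]
  (w : HeightOneSpectrum (𝓞 K))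

omit [Fact p.Prime] in
/-- Points of `(W_K)(K̄_w)` whose coordinates lie in `K_w` are fixed by `Γ_{K_w}`. [cite: SilvermanAEC2009, VIII §1] -/
theorem smul_map_toAlgHom_eq (σ : absoluteGaloisGroup (w.adicCompletion K))
    (R : ((W.baseChange K).baseChange (w.adicCompletion K)).toAffine.Point) :
    σ • (show localPoints (W.baseChange K) (w.adicCompletion K) from
        Affine.Point.map (W' := (W.baseChange K).toAffine)
          (IsScalarTower.toAlgHom K (w.adicCompletion K) (AlgebraicClosure (w.adicCompletion K))) R) =
      Affine.Point.map (W' := (W.baseChange K).toAffine)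
        (IsScalarTower.toAlgHom K (w.adicCompletion K) (AlgebraicClosure (w.adicCompletion K))) R := by
  have hcomp : ((AlgEquiv.restrictScalars K (show AlgebraicClosure (w.adicCompletion K) ≃ₐ[w.adicCompletion K]
        AlgebraicClosure (w.adicCompletion K) from σ) : AlgebraicClosure (w.adicCompletion K) ≃ₐ[K]
          AlgebraicClosure (w.adicCompletion K)) : AlgebraicClosure (w.adicCompletion K) →ₐ[K] AlgebraicClosure (w.adicCompletion K)).comp
      (IsScalarTower.toAlgHom K (w.adicCompletion K) (AlgebraicClosure (w.adicCompletion K))) =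
      IsScalarTower.toAlgHom K (w.adicCompletion K) (AlgebraicClosure (w.adicCompletion K)) := by
    ext z
    exact σ.commutes z
  rw [localPoints.smul_def]
  change Affine.Point.map _ (Affine.Point.map _ R) = _
  rw [Affine.Point.map_map, hcomp]

/-- **TRANSPORT `E(K_w) = W(ℚ_p)` AT A DEGREE-ONE PLACE.** `W/ℚ`, `K` a number field, `w` a finite place with a SURJECTIVE ring map
`φ : ℚ_p → K_w` (i.e. `K_w ≅ ℚ_p`), `P ∈ W(ℚ)`, `m : ℕ`. Then `P_K = m•y + T` in `E(K̄_w)` with `y` fixed by `Γ_{K_w}` and `T` torsion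
IFF `toPadicPoint p P = m•y + T` in `W(ℚ_p)` with `T` torsion. [cite: SilvermanAEC2009, I §1 and VIII §1] [cite: NeukirchANT1999, Ch. II (8.5)] -/
theorem exists_localPoints_iff_exists_padicPoint (φ : ℚ_[p] →+* w.adicCompletion K) (hφ : Function.Surjective φ)
    (P : W.toAffine.Point) (m : ℕ) :
    (∃ y T : localPoints (W.baseChange K) (w.adicCompletion K),
        (∀ σ : absoluteGaloisGroup (w.adicCompletion K), σ • y = y) ∧ IsOfFinAddOrder T ∧
        m • y + T = pointsMap (W.baseChange K) (w.adicCompletion K)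
          (toGeomPoints (W.baseChange K) (Affine.Point.map (W' := W.toAffine) (Algebra.ofId ℚ K) P))) ↔
      ∃ y T : (W.baseChange ℚ_[p]).toAffine.Point, IsOfFinAddOrder T ∧ m • y + T = W.toPadicPoint p P := by
  -- notation and the comparison map `F`
  set E := w.adicCompletion K with hE
  haveI : CharZero E := charZero_of_injective_algebraMap (algebraMap K E).injective
  let ψ : ℚ_[p] →ₐ[ℚ] AlgebraicClosure E := ((algebraMap E (AlgebraicClosure E)).comp φ).toRatAlgHom
  let ι : E →ₐ[K] AlgebraicClosure E := IsScalarTower.toAlgHom K E (AlgebraicClosure E)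
  have hψ : ∀ a : ℚ_[p], ψ a = algebraMap E (AlgebraicClosure E) (φ a) := fun a ↦ rfl
  have hι : ∀ z : E, ι z = algebraMap E (AlgebraicClosure E) z := fun z ↦ rfl
  have hcurve : (W.baseChange K).baseChange (AlgebraicClosure E) = W.baseChange (AlgebraicClosure E) := by
    rw [WeierstrassCurve.baseChange, WeierstrassCurve.baseChange, WeierstrassCurve.baseChange, WeierstrassCurve.map_map]
    exact congrArg W.map (Subsingleton.elim _ _)
  let F : (W.baseChange ℚ_[p]).toAffine.Point →+ localPoints (W.baseChange K) E :=
    (Affine.Point.congrEquiv hcurve.symm).toAddMonoidHom.comp (Affine.Point.map (W' := W.toAffine) ψ)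
  have hFapply : ∀ y, F y = Affine.Point.congrEquiv hcurve.symm (Affine.Point.map (W' := W.toAffine) ψ y) := fun _ ↦ rfl
  have hFinj : Function.Injective F := fun a b h ↦
    Affine.Point.map_injective (W' := W.toAffine) ψ ((Affine.Point.congrEquiv hcurve.symm).injective h)
  -- the image of `F` is the `Γ_{K_w}`-fixed part
  have hFfix : ∀ (σ : absoluteGaloisGroup E) (y : (W.baseChange ℚ_[p]).toAffine.Point), σ • F y = F y := by
    intro σ y
    rcases y with _ | ⟨a, b, h⟩
    · change σ • F 0 = F 0
      rw [map_zero, smul_zero]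
    · rw [hFapply, Affine.Point.map_some, Affine.Point.congrEquiv_some, localPoints.smul_def]
      change Affine.Point.map _ (Affine.Point.some _ _ _) = _
      rw [Affine.Point.map_some]
      exact Affine.Point.some_eq_some_of_eq (σ.commutes (φ a)) (σ.commutes (φ b))
  have hFsurj : ∀ R : localPoints (W.baseChange K) E, (∀ σ : absoluteGaloisGroup E, σ • R = R) → ∃ y, F y = R := by
    intro R hR
    obtain ⟨R₁, rfl⟩ := exists_map_eq_of_forall_smul_localPoints_eq (W.baseChange K) E hR
    rcases R₁ with _ | ⟨a, b, h⟩
    · exact ⟨0, by rw [map_zero]; rfl⟩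
    · obtain ⟨a₀, rfl⟩ := hφ a
      obtain ⟨b₀, rfl⟩ := hφ b
      have h' : ((W.baseChange K).baseChange (AlgebraicClosure E)).toAffine.Nonsingular (ι (φ a₀)) (ι (φ b₀)) :=
        (Affine.baseChange_nonsingular (W.baseChange K) (f := ι) (algebraMap E (AlgebraicClosure E)).injective _ _).mpr h
      have h'' : (W.baseChange (AlgebraicClosure E)).toAffine.Nonsingular (ψ a₀) (ψ b₀) := by
        rw [← hcurve, hψ, hψ]; exact h'
      have h₀ : (W.baseChange ℚ_[p]).toAffine.Nonsingular a₀ b₀ :=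
        (Affine.baseChange_nonsingular W (f := ψ) ψ.toRingHom.injective a₀ b₀).mp h''
      refine ⟨Affine.Point.some a₀ b₀ h₀, ?_⟩
      rw [hFapply, Affine.Point.map_some, Affine.Point.congrEquiv_some, Affine.Point.map_some]
      exact Affine.Point.some_eq_some_of_eq (hψ a₀) (hψ b₀)
  -- `F` carries `toPadicPoint p P` to the local image of `P_K`
  have hFP : F (W.toPadicPoint p P) = pointsMap (W.baseChange K) E
      (toGeomPoints (W.baseChange K) (Affine.Point.map (W' := W.toAffine) (Algebra.ofId ℚ K) P)) := by
    rcases P with _ | ⟨x, y, hxy⟩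
    · change F 0 = pointsMap (W.baseChange K) E (toGeomPoints (W.baseChange K) 0)
      rw [map_zero, map_zero, map_zero]
    · -- LHS: `(ψ x, ψ y)`
      obtain ⟨h₁, hL⟩ : ∃ h₁, F (W.toPadicPoint p (.some x y hxy)) =
          Affine.Point.congrEquiv hcurve.symm (.some (ψ (x : ℚ_[p])) (ψ (y : ℚ_[p])) h₁) :=
        ⟨_, by rw [toPadicPoint_some, hFapply, Affine.Point.map_some]⟩
      rw [hL, Affine.Point.congrEquiv_some]
      -- RHS: `(ι_E ι_K x, ι_E ι_K y)`
      have hK' : (W.baseChange K).toAffine.Nonsingular (x : K) (y : K) := by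
        have := (Affine.baseChange_nonsingular (W := W.toAffine) (f := Algebra.ofId ℚ K)
          (Algebra.ofId ℚ K).toRingHom.injective x y).mpr hxy
        simpa only [eq_ratCast] using this
      have hPK : Affine.Point.map (W' := W.toAffine) (Algebra.ofId ℚ K) (show W.toAffine.Point from .some x y hxy) =
          .some (x : K) (y : K) hK' :=
        (Affine.Point.map_some (W' := W.toAffine) (Algebra.ofId ℚ K) hxy).trans
          (Affine.Point.some_eq_some_of_eq (eq_ratCast _ x) (eq_ratCast _ y))
      rw [hPK]
      obtain ⟨h₂, hG⟩ : ∃ h₂, toGeomPoints (W.baseChange K) (.some (x : K) (y : K) hK') =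
          (.some (algebraMap K (AlgebraicClosure K) (x : K)) (algebraMap K (AlgebraicClosure K) (y : K)) h₂ :
            geomPoints (W.baseChange K)) :=
        ⟨_, rfl⟩
      rw [hG]
      obtain ⟨h₃, hM⟩ : ∃ h₃, pointsMap (W.baseChange K) E (.some (algebraMap K (AlgebraicClosure K) (x : K))
          (algebraMap K (AlgebraicClosure K) (y : K)) h₂ : geomPoints (W.baseChange K)) =
          (show localPoints (W.baseChange K) E from .some (closureEmb (K := K) E (algebraMap K (AlgebraicClosure K) (x : K)))
            (closureEmb (K := K) E (algebraMap K (AlgebraicClosure K) (y : K))) h₃) :=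
        ⟨_, rfl⟩
      rw [hM]
      have hc : ∀ q : ℚ, ψ (q : ℚ_[p]) = closureEmb (K := K) E (algebraMap K (AlgebraicClosure K) (q : K)) := fun q ↦ by
        simp only [map_ratCast]
      exact Affine.Point.some_eq_some_of_eq (hc x) (hc y)
  -- the equivalence
  constructor
  · rintro ⟨y, T, hy, hT, heq⟩
    obtain ⟨y₀, rfl⟩ := hFsurj y hy
    have hT' : F (W.toPadicPoint p P - m • y₀) = T := by
      rw [map_sub, map_nsmul, hFP, ← heq, add_sub_cancel_left]
    refine ⟨y₀, W.toPadicPoint p P - m • y₀, ?_, by abel⟩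
    rw [← hFinj.isOfFinAddOrder_iff, hT']
    exact hT
  · rintro ⟨y₀, T₀, hT₀, heq⟩
    refine ⟨F y₀, F T₀, fun σ ↦ hFfix σ y₀, F.isOfFinAddOrder hT₀, ?_⟩
    rw [← map_nsmul, ← map_add, heq, hFP]

end Transport

/-! ## The S3c frame at `v̄` -/

section Frame

open Summit.BirchSwinnertonDyer.BirchSwinnertonDyer.Theorems.PrintCf2.LocalPointsScalar

variable {K : Type} [Field K] [NumberField K]

/-- **`K_{v̄} ≅ ℚ₂` on the frame**: for a quadratic `K` with two places `v ≠ v̄` above `2`, the canonical `ℚ₂ → K_{v̄}` is surjective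
(`[K_{v̄} : ℚ₂] = e·f = 1`). [cite: NeukirchANT1999, Ch. I §8 Prop. (8.2) and Ch. II (8.5)] -/
theorem exists_surjective_padic_adicCompletion (hK2 : Module.finrank ℚ K = 2) {v vbar : HeightOneSpectrum (𝓞 K)}
    (hv : ((2 : ℕ) : 𝓞 K) ∈ v.asIdeal) (hvbar : ((2 : ℕ) : 𝓞 K) ∈ vbar.asIdeal) (hne : vbar ≠ v) :
    ∃ φ : ℚ_[2] →+* vbar.adicCompletion K, Function.Surjective φ := by
  haveI : Fact (Nat.Prime 2) := ⟨Nat.prime_two⟩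
  letI : Algebra ℚ_[2] (vbar.adicCompletion K) := LocalField.adicCompletionPadicAlgebra vbar 2 hvbar
  have h1 : Module.finrank ℚ_[2] (vbar.adicCompletion K) = 1 := by
    rw [Literature.NumberTheory.NumberFields.finrank_adicCompletionPadicAlgebra_eq 2 vbar hvbar]
    exact ramificationIdx_mul_inertiaDeg_eq_one_of_ne hK2 hvbar hv hne.symm
  refine ⟨algebraMap ℚ_[2] (vbar.adicCompletion K), fun z ↦ ?_⟩
  obtain ⟨c, hc⟩ := (finrank_eq_one_iff_of_nonzero' (1 : vbar.adicCompletion K) one_ne_zero).mp h1 z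
  exact ⟨c, by rw [Algebra.algebraMap_eq_smul_one]; exact hc⟩

/-- **(F1) piece (D) on the S3c frame**: for a quadratic `K`, `v ≠ v̄` above `2`, `W/ℚ`, `P ∈ W(ℚ)`, `m : ℕ`:
`P_K ∈ m·E(K_{v̄}) + tors` (in `E(K̄_{v̄})^{Γ}`) ⟺ `toPadicPoint 2 P ∈ m·W(ℚ₂) + tors`. [cite: SilvermanAEC2009, VIII §1]
[cite: NeukirchANT1999, Ch. II (8.5)] -/
theorem exists_localPoints_iff_exists_padicPoint_of_frame (hK2 : Module.finrank ℚ K = 2) {v vbar : HeightOneSpectrum (𝓞 K)}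
    (hv : ((2 : ℕ) : 𝓞 K) ∈ v.asIdeal) (hvbar : ((2 : ℕ) : 𝓞 K) ∈ vbar.asIdeal) (hne : vbar ≠ v)
    (W : WeierstrassCurve ℚ) (P : W.toAffine.Point) (m : ℕ) :
    (∃ y T : localPoints (W.baseChange K) (vbar.adicCompletion K),
        (∀ σ : absoluteGaloisGroup (vbar.adicCompletion K), σ • y = y) ∧ IsOfFinAddOrder T ∧
        m • y + T = pointsMap (W.baseChange K) (vbar.adicCompletion K)
          (toGeomPoints (W.baseChange K) (Affine.Point.map (W' := W.toAffine) (Algebra.ofId ℚ K) P))) ↔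
      ∃ y T : (W.baseChange ℚ_[2]).toAffine.Point, IsOfFinAddOrder T ∧ m • y + T = W.toPadicPoint 2 P := by
  haveI : Fact (Nat.Prime 2) := ⟨Nat.prime_two⟩
  obtain ⟨φ, hφ⟩ := exists_surjective_padic_adicCompletion hK2 hv hvbar hne
  exact exists_localPoints_iff_exists_padicPoint W 2 vbar φ hφ P m

end Frame

end Summit.BirchSwinnertonDyer.BirchSwinnertonDyer.Theorems.PrintCf2.RestrictedSelmerPair

end
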